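import Literature.MathematicalPhysics.QuantumFieldTheory.Balaban1983to89.B5Eq147TorusBridge
import Literature.MathematicalPhysics.QuantumFieldTheory.Balaban1983to89.B8Eq127LandauGauge
import Literature.MathematicalPhysics.QuantumFieldTheory.Balaban1983to89.B6Eq28LandauGaugeV1
import Literature.MathematicalPhysics.QuantumFieldTheory.Balaban1983to89.B6SectAOperatorsV1

/-!
# `Balaban1983to89.B8Eq127LandauDictionary` — ONE Landau gauge condition in four papers: [Balaban1985RegularSpaces] (1.27)/(1.38)
«R(U₀)D^{η*}_{U₀}A = 0» (r05's abstract `B8Eq127LandauGauge.IsLandauBG Δ q X`), [Balaban1984PropagatorsI] (1.47)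
«{A : R∂*A = 0}» on the torus tower (`B5Eq147Landau.Lan`, p16 gen 2), [BalabanImbrieJaffe1985] (4.4.1)–(4.4.2) on the V1
lattices (`BIJ85LandauForm441.LandauOps.projR`, p09; `B5Eq164LandauV1.lan`, p38) and [Balaban1984PropagatorsII] (2.9)/(2.12)
one level (`LatticeFieldCalculus.IsLandauGauge`, r18) — KNITTING: the four typings are literally `IsLandauBG` at four instances

statement-level skeleton of published theorems with citation tags; proofs where landed; nothing here is a claim about the Yang–Mills mass gap

PRINT.  [Balaban1985RegularSpaces] p. 80 [PDF 6, held `paper:balaban1985-cmp99-regular-spaces-gauge-fixing`, journal page =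
PDF page + 74], quoted from r05's module `B8Eq127LandauGauge`: «Let us recall the definition of this gauge, as it was given in
[2, 4]. We consider the subspace N(Q′(U₀)) = {λ : Q′(U₀)λ = 0} of the space L²(Ω₀, 𝔤) … R(U₀) is defined as an orthogonal
projection in this real Hilbert space, onto the subspace Δ^η_{U₀}N(Q′(U₀)) … R(U₀)D^{η*}_{U₀}(1/i) log U′ = 0 (1.27)»; here
«[2]» = [Balaban1984PropagatorsI]/[Balaban1984PropagatorsII] and «[4]» = [Balaban1985BackgroundPropagators].
[Balaban1984PropagatorsI] p. 25 [PDF 9, held `paper:balaban1984-cmp95-propagators-rt-i`, +16] L2–4: «The projection operator R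
has a clear meaning. It is an orthogonal projection on the linear subspace ΔN(Q′_k) of L²(T_η), N(Q′_k) = {λ : Q′_kλ = 0}.»
(verbatim; v1.2 docstring fix after r05's QUOTE-AUDIT-B8 finding A1), (1.47) p. 26 [PDF 10] L17–18 «δ_R(∂*A)».
[Balaban1984PropagatorsII] p. 225 [PDF 3]: «let R be an orthogonal projection in the space L²(T_η) onto the
subspace ΔN(Q′) … R∂*A = 0 (2.12)».  [BalabanImbrieJaffe1985] (4.4.1)–(4.4.2) p. 311–312: «δ_R(∂*A) … R projects onto
ΔN(Q′)» (typed by p09 as `LandauOps.projR := (N(Q′).map Δ).starProjection`).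

CITATION HEADER (lean-in-tree rule) — WHAT IS REPRODUCED.  Phase-2 file of the `lit-balaban` typed skeleton (HOME
`run/shared/lean/pub/lit-balaban/`), seat p16 gen 4: cross-paper KNITTING of SKELETON rows **B8.Eq1.27** (r05; typed
p245955 `IsLandauBG`, «cf. the abelian one-level V1 form `LatticeFieldCalculus.IsLandauGauge` (r18) … not bridged here»),
**B5.Eq1.47** (r02; `B5Eq147Landau.Lan`), **C1.Eq4.4.1-4.4.3** (r15; `LandauOps.projR`, `B5Eq164LandauV1.lan`) and
**B5.Eq2.8-1.27 / B6.Eq2.12** (r18 X05 / r03; `IsLandauGauge`, this seat's `B6Eq28LandauGaugeV1`).  Objects BY NAME: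
`B8Eq127LandauGauge.IsLandauBG`, `landauSpace`, `isLandauBG_iff_forall_mem`, `mem_landauSpace_iff` (r05, p245955),
`B9Eq325Proj.lapKer` (p07), `BIJ85LandauForm441.LandauOps` (`kerQp`, `gaugeRange`, `projR`; p09), `BIJ85LandauMinimizer442V1.opsV1`
(p11), `B5Eq164LandauV1.lan`/`mem_lan` (p38), `B5Eq147Landau.Lan`/`Lap`/`Qsk`/`Dv`/`lapResid`/`mem_Lan_iff_inner` (p16 gen 2),
`B5Eq117TorusCarriers.tV` (p16 gen 3), `B5Eq147TorusBridge.projR_eq_zero_iff` (p16 gen 4); v1.1 adds the import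
`B6Eq28LandauGaugeV1` (`isLandauGauge_iff_projR_eq_zero` / `isLandauGauge_iff_tV_mem_Lan`, p16 gen 4; the v1 declarations are
byte-identical).  NO definition, NO `def … : Prop` (theorems only).

WHAT IS PROVED (kernel, no `sorry`, standard axioms):
* §1 ABSTRACT (every instance `D` of p09's `LandauOps` with finite-dimensional site space): **`projR_eq_zero_iff_isLandauBG_comp`**
  (`D.projR u = 0 ↔ IsLandauBG D.lap (e ∘ D.Qp) u` for every injective linear reading `e` of the block-average space in a Hilbert
  space — [BIJ85]'s «R u = 0» IS [B8]'s (1.27) condition at the background U₀ = 1), `ker_projR_eq_landauSpace_comp`; when the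
  block-average space is itself a Hilbert space: `gaugeRange_eq_lapKer` (`D.gaugeRange = lapKer D.lap D.Qp`, definitional),
  `projR_eq_zero_iff_isLandauBG`, `ker_projR_eq_landauSpace`.
* §2 V1 (every `k`, every `c, s`; `Q′_k` read in `ℓ²(T^{(k)}_1)`): **`mem_lan_iff_isLandauBG`** (`A ∈ B5Eq164LandauV1.lan P k c s ↔
  IsLandauBG (opsV1).lap (ℓ² ∘ (opsV1).Qp) ((opsV1).dstar A)`), `lan_eq_comap_landauSpace`; one level (v1.1, append-only,
  2026-08-21): **`isLandauGauge_iff_isLandauBG`** (r18's (2.9)/(2.12) `IsLandauGauge c A ↔ IsLandauBG … (∂*(toLp A))` at `k = 1`,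
  every `c, c′, s′ ≠ 0`).
* §3 TOWER (every `k`): `lapResid_eq_lapKer` (definitional), **`mem_Lan_iff_isLandauBG`** (`A ∈ B5Eq147Landau.Lan L M k ↔
  IsLandauBG (Lap L M k) (Qsk L M k) (Dv L M k A)`), `Lan_eq_comap_landauSpace`, and (v1.1) at `k = 1` from the finest V1 lattice **`isLandauGauge_iff_isLandauBG_tower`**.

HONEST SCOPE.  U₀ = 1 (flat background), U(1)/real fields: [B8]'s (1.27) is stated for a general (regular) background U₀ with
covariant Δ^η_{U₀}, Q′(U₀) and 𝔤-valued fields — r05's `IsLandauBG Δ q` is abstract in (Δ, q) and is met here only at the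
flat abelian instances the tree holds ([B5]/[BIJ85]/[B6] one level or k levels on tori); r05's lattice forms `LandauBGL` /
`Landau138L` / `Landau138One` on the [B9] carriers (`B9Thm311Lattice`) are NOT bridged (different carriers: site/bond Finsets
with transports vs `LatticeFieldCalculus.Setup` tori).  Nothing about existence/uniqueness beyond what the imported files prove
(`B6Eq28LandauGaugeV1.existsUnique_landauGauge`, `B5Eq147Landau.isCompl_Lan_orbit`), no bound, no statement about B8's
Theorems 2/4/8.

Unit `lit-balaban-p16` gen 4 (Phase-2 proof seat p16; literature-prover-lit-balaban-p16-g4-0), HOME `run/shared/lean/pub/lit-balaban/`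
(STATUS: `lit-balaban-p16/STATUS.md`), 2026-08-21.
v1.2 (p16 gen 5, literature-prover-lit-balaban-p16-g5-0, 2026-08-21; append-only, + import `B6SectAOperatorsV1`): §4 MULTI-LEVEL —
p21's concrete multi-scale `R = RE D c` of [B6] (2.10)–(2.12), for EVERY nested family `D : B6SectADomainsV1.Domains P`, satisfies
`RE D c v = 0 ↔ IsLandauBG (lapE c) (QpE D) v`: [B6] (2.12) multi-level IS [B8] (1.27) at U₀ = 1 (`KE_eq_lapKer` (definitional),
`RE_eq_zero_iff_isLandauBG`, `gauge212_iff_isLandauBG`, `ker_RE_eq_landauSpace`, `ker_RE_comp_dsE_eq_comap_landauSpace`); SKELETON rows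
B8.Eq1.27 ↔ B6.Eq2.12 (multi-level).
-/

open scoped BigOperators InnerProductSpace

namespace Literature.MathematicalPhysics.QuantumFieldTheory.Balaban1983to89

namespace B8Eq127LandauDictionary

open B8Eq127LandauGauge (IsLandauBG landauSpace isLandauBG_iff isLandauBG_iff_forall_mem mem_landauSpace_iff)
open B9Eq325Proj (lapKer mem_lapKer)
open Literature.MathematicalPhysics.QuantumFieldTheory.BalabanImbrieJaffe1984to88.BIJ85LandauForm441
open Literature.MathematicalPhysics.QuantumFieldTheory.BalabanImbrieJaffe1984to88.BIJ85LandauMinimizer442V1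
open Literature.MathematicalPhysics.QuantumFieldTheory.BalabanImbrieJaffe1984to88.BIJ85AxialPropagator411 (BondSpace)

noncomputable section

/-! ## §1  Abstract: [BIJ85] «R u = 0» (p09's `LandauOps.projR`) IS [B8] (1.27) `IsLandauBG` at (Δ, Q′) = (D.lap, D.Qp) -/

section Generic

variable {EA ES EP EB ES' F : Type*}
  [NormedAddCommGroup EA] [InnerProductSpace ℝ EA]
  [NormedAddCommGroup ES] [InnerProductSpace ℝ ES]
  [NormedAddCommGroup EP] [InnerProductSpace ℝ EP]
  [AddCommGroup EB] [Module ℝ EB] [AddCommGroup ES'] [Module ℝ ES']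
  [NormedAddCommGroup F] [InnerProductSpace ℝ F]

/-- **[BIJ85] (4.4.1) «R u = 0» ⟺ [B8] (1.27) at U₀ = 1**: for every instance `D` of the (4.4.x) operators and every INJECTIVE
linear reading `e` of the block-average space in a Hilbert space (r05's `IsLandauBG Δ q` sees `q` only through `ker q`),
`D.projR u = 0 ↔ IsLandauBG D.lap (e ∘ D.Qp) u` («⟨Δλ, u⟩ = 0 for every λ ∈ N(Q′)»). [cite: Balaban1985RegularSpaces, (1.27) p.80] -/
theorem projR_eq_zero_iff_isLandauBG_comp (D : LandauOps EA ES EP EB ES') [FiniteDimensional ℝ ES] (e : ES' →ₗ[ℝ] F)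
    (he : Function.Injective e) (u : ES) : D.projR u = 0 ↔ IsLandauBG D.lap (e ∘ₗ D.Qp) u := by
  rw [B5Eq147TorusBridge.projR_eq_zero_iff, isLandauBG_iff]
  refine forall_congr' fun l => ?_
  rw [LinearMap.comp_apply, map_eq_zero_iff e he]

/-- `ker R = ∂*`-free form: `ker D.projR = landauSpace D.lap (e ∘ D.Qp)` (r05's Landau subspace `(ΔN(Q′))ᗮ`).
[cite: Balaban1985RegularSpaces, (1.27) p.80] -/
theorem ker_projR_eq_landauSpace_comp (D : LandauOps EA ES EP EB ES') [FiniteDimensional ℝ ES] (e : ES' →ₗ[ℝ] F)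
    (he : Function.Injective e) : LinearMap.ker (D.projR : ES →ₗ[ℝ] ES) = landauSpace D.lap (e ∘ₗ D.Qp) := by
  ext u
  rw [LinearMap.mem_ker, ContinuousLinearMap.coe_coe, projR_eq_zero_iff_isLandauBG_comp D e he, mem_landauSpace_iff]

end Generic

section GenericHilbert

variable {EA ES EP EB ES' : Type*}
  [NormedAddCommGroup EA] [InnerProductSpace ℝ EA]
  [NormedAddCommGroup ES] [InnerProductSpace ℝ ES]
  [NormedAddCommGroup EP] [InnerProductSpace ℝ EP]
  [AddCommGroup EB] [Module ℝ EB]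
  [NormedAddCommGroup ES'] [InnerProductSpace ℝ ES']

/-- the subspace «ΔN(Q′)» of [BIJ85] (4.4.1) (p09's `gaugeRange`) is [B9] (3.21)/[B8] p. 80's «Δ^η_{U₀}N(Q′(U₀))» (p07's `lapKer`)
at (Δ, q) = (D.lap, D.Qp) — definitionally (block-average space itself a Hilbert space). [cite: Balaban1985RegularSpaces, (1.27) p.80] -/
theorem gaugeRange_eq_lapKer (D : LandauOps EA ES EP EB ES') : D.gaugeRange = lapKer D.lap D.Qp := rfl

/-- **[BIJ85] (4.4.1) «R u = 0» ⟺ [B8] (1.27)** when the block-average space is itself a Hilbert space: `D.projR u = 0 ↔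
IsLandauBG D.lap D.Qp u`. [cite: Balaban1985RegularSpaces, (1.27) p.80] -/
theorem projR_eq_zero_iff_isLandauBG (D : LandauOps EA ES EP EB ES') [FiniteDimensional ℝ ES] (u : ES) :
    D.projR u = 0 ↔ IsLandauBG D.lap D.Qp u := by
  rw [B5Eq147TorusBridge.projR_eq_zero_iff, isLandauBG_iff]

/-- `ker R = ` r05's Landau subspace `(ΔN(Q′))ᗮ`. [cite: Balaban1985RegularSpaces, (1.27) p.80] -/
theorem ker_projR_eq_landauSpace (D : LandauOps EA ES EP EB ES') [FiniteDimensional ℝ ES] :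
    LinearMap.ker (D.projR : ES →ₗ[ℝ] ES) = landauSpace D.lap D.Qp := by
  ext u
  rw [LinearMap.mem_ker, ContinuousLinearMap.coe_coe, projR_eq_zero_iff_isLandauBG, mem_landauSpace_iff]

end GenericHilbert

/-! ## §2  V1: p38's Landau subspace `lan` and r18's one-level `IsLandauGauge` are `IsLandauBG` at the instance `opsV1`
(p11's `opsV1` reads `Q′_k` into the plain function space `SiteField P k ℝ`; it is composed with the identity reading
`(WithLp.linearEquiv 2 ℝ _).symm` into `ℓ²(T^{(k)}_1)` — `IsLandauBG Δ q` depends on `q` only through `ker q`) -/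

section V1

open LatticeFieldCalculus

variable {P : Params} {k : ℕ}

/-- **[BIJ85] (4.4.2)/[B5] (1.47) on V1 = [B8] (1.27) at `opsV1`**: `A ∈ lan P k c s ↔ IsLandauBG Δ Q′_k (∂*A)` (every `k, c, s`).
[cite: Balaban1985RegularSpaces, (1.27) p.80] -/
theorem mem_lan_iff_isLandauBG (k : ℕ) (c s : ℝ) (A : BondSpace P) :
    A ∈ B5Eq164LandauV1.lan P k c s ↔
      IsLandauBG (opsV1 P k c s).lap
        ((WithLp.linearEquiv 2 ℝ (SiteField P k ℝ)).symm.toLinearMap ∘ₗ (opsV1 P k c s).Qp) ((opsV1 P k c s).dstar A) := by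
  rw [B5Eq164LandauV1.mem_lan, projR_eq_zero_iff_isLandauBG_comp (opsV1 P k c s) _ (WithLp.linearEquiv 2 ℝ _).symm.injective]

/-- `lan = ∂*⁻¹(landauSpace)`. [cite: Balaban1985RegularSpaces, (1.27) p.80] -/
theorem lan_eq_comap_landauSpace (k : ℕ) (c s : ℝ) :
    B5Eq164LandauV1.lan P k c s
      = (landauSpace (opsV1 P k c s).lap
          ((WithLp.linearEquiv 2 ℝ (SiteField P k ℝ)).symm.toLinearMap ∘ₗ (opsV1 P k c s).Qp)).comap
          (opsV1 P k c s).dstar := by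
  ext A
  rw [mem_lan_iff_isLandauBG, Submodule.mem_comap, mem_landauSpace_iff]

/-- **[B6] (2.9)/(2.12) one level (r18's `IsLandauGauge`) = [B8] (1.27) at `opsV1 P 1 c′ s′`** (finest lattice, `c, c′, s′ ≠ 0`).
[cite: Balaban1985RegularSpaces, (1.27) p.80] -/
theorem isLandauGauge_iff_isLandauBG {c c' s' : ℝ} (hc : c ≠ 0) (hc' : c' ≠ 0) (hs' : s' ≠ 0) (A : VecField P 0 ℝ) :
    IsLandauGauge c A ↔
      IsLandauBG (opsV1 P 1 c' s').lap
        ((WithLp.linearEquiv 2 ℝ (SiteField P 1 ℝ)).symm.toLinearMap ∘ₗ (opsV1 P 1 c' s').Qp)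
        ((opsV1 P 1 c' s').dstar (WithLp.toLp 2 A : BondSpace P)) := by
  rw [B6Eq28LandauGaugeV1.isLandauGauge_iff_projR_eq_zero hc hc' hs',
    projR_eq_zero_iff_isLandauBG_comp (opsV1 P 1 c' s') _ (WithLp.linearEquiv 2 ℝ _).symm.injective]

end V1

/-! ## §3  Tower: `B5Eq147Landau.Lan L M k` is `IsLandauBG` at (Δ, Q′_k, ∂*) = (`Lap`, `Qsk`, `Dv`) -/

section Tower

open B5SectBStatements B5Eq147Landau B5Eq117TorusCarriers
open LatticeFieldCalculus

variable {d : ℕ} (L : ℕ) (M : Fin d → ℕ) [NeZero L] [∀ μ, NeZero (M μ)]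

/-- p16 gen 2's `lapResid = (ker Q′_k).map Δ` is p07's `lapKer Δ Q′_k` — definitionally. [cite: Balaban1984PropagatorsI, p.25 (text)] -/
theorem lapResid_eq_lapKer (k : ℕ) : lapResid L M k = lapKer (Lap L M k) (Qsk L M k) := rfl

/-- **[B5] (1.47) «R∂*A = 0» on the tower = [B8] (1.27) at (`Lap`, `Qsk`)**: `A ∈ Lan L M k ↔ IsLandauBG (Lap L M k) (Qsk L M k) (Dv L M k A)`.
[cite: Balaban1985RegularSpaces, (1.27) p.80] -/
theorem mem_Lan_iff_isLandauBG (k : ℕ) (A : Fld (towerM L M k)) :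
    A ∈ Lan L M k ↔ IsLandauBG (Lap L M k) (Qsk L M k) (Dv L M k A) := by
  rw [mem_Lan_iff_inner, isLandauBG_iff]
  refine forall_congr' fun l => forall_congr' fun _ => ?_
  rw [real_inner_comm]

/-- `Lan = ∂*⁻¹(landauSpace)` on the tower. [cite: Balaban1984PropagatorsI, (1.47) p.26] -/
theorem Lan_eq_comap_landauSpace (k : ℕ) :
    Lan L M k = (landauSpace (Lap L M k) (Qsk L M k)).comap (Dv L M k) := by
  ext A
  rw [mem_Lan_iff_isLandauBG, Submodule.mem_comap, mem_landauSpace_iff]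

/-- **[B6] (2.12) one level on the finest V1 lattice = [B8] (1.27) on the torus tower at `k = 1`** (`c ≠ 0`, `1 ≤ m + K`).
[cite: Balaban1984PropagatorsII, (2.12) p.225] -/
theorem isLandauGauge_iff_isLandauBG_tower {P : Params} (h1 : 1 ≤ P.m + P.K) {c : ℝ} (hc : c ≠ 0) (A : VecField P 0 ℝ) :
    IsLandauGauge c A ↔
      IsLandauBG (Lap P.L (Mk P 1) 1) (Qsk P.L (Mk P 1) 1) (Dv P.L (Mk P 1) 1 (tV h1 A)) := by
  rw [B6Eq28LandauGaugeV1.isLandauGauge_iff_tV_mem_Lan h1 hc, mem_Lan_iff_isLandauBG]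

end Tower

/-! ## §4  (v1.2, p16 gen 5) MULTI-LEVEL: [B6] (2.12) `R∂*A = 0` for EVERY nested family of domains (p21's concrete Sect. A
operators `B6SectAOperatorsV1`: the multi-scale `Q′ = QpE D`, `Δ = lapE c`, `R = RE D c` = the orthogonal projection onto
`ΔN(Q′)`) IS [B8] (1.27) `IsLandauBG` at `(Δ, Q′(U₀)) = (lapE c, QpE D)` — the abelian `U₀ = 1` instance of «R(U₀)D^{η*}_{U₀}A = 0»
with the SAME multi-level `N(Q′)` of [B8] p. 80 / [B6] (2.7) -/

section MultiLevel

open B6SectADomainsV1 B6SectAOperatorsV1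

variable {P : Params} (D : Domains P)

/-- p21's `ΔN(Q′)` (`KE D c`) IS r05's `lapKer (lapE c) (QpE D)` — one subspace. [cite: Balaban1984PropagatorsII, (2.10) p.225] -/
theorem KE_eq_lapKer (c : ℝ) : KE D c = lapKer (lapE c) (QpE D) := rfl

/-- **[B6] (2.12) multi-level = [B8] (1.27) at U₀ = 1**: for every nested family `D` and every `v ∈ L²(T_η)`, p21's `R v = 0` iff
r05's `IsLandauBG (lapE c) (QpE D) v` («⟨Δλ, v⟩ = 0 for every λ ∈ N(Q′)» — p21's `RE_eq_zero_iff`). [cite: Balaban1985RegularSpaces, (1.27) p.80] -/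
theorem RE_eq_zero_iff_isLandauBG (c : ℝ) (v : ScalarSpace P) : RE D c v = 0 ↔ IsLandauBG (lapE c) (QpE D) v := by
  rw [RE_eq_zero_iff, isLandauBG_iff]
  exact forall_congr' fun l => by rw [LinearMap.mem_ker]

/-- hence the gauge condition (2.12) `R∂*A = 0` of an `A` on the fine torus is the (1.27) condition on `X = ∂*A`.
[cite: Balaban1984PropagatorsII, (2.12) p.225] -/
theorem gauge212_iff_isLandauBG (c : ℝ) (x : BondSpace P) :
    RE D c (dsE c x) = 0 ↔ IsLandauBG (lapE c) (QpE D) (dsE c x) :=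
  RE_eq_zero_iff_isLandauBG D c (dsE c x)

/-- `ker R = landauSpace` (r05's «the surface given by (1.27)» in the variable `X`). [cite: Balaban1985RegularSpaces, (1.27) p.80] -/
theorem ker_RE_eq_landauSpace (c : ℝ) : LinearMap.ker (RE D c) = landauSpace (lapE c) (QpE D) := by
  ext v
  rw [LinearMap.mem_ker, RE_eq_zero_iff_isLandauBG, mem_landauSpace_iff]

/-- the multi-level Landau configurations `{A : R∂*A = 0}` = `∂*⁻¹(landauSpace)`. [cite: Balaban1984PropagatorsII, (2.12) p.225] -/
theorem ker_RE_comp_dsE_eq_comap_landauSpace (c : ℝ) :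
    LinearMap.ker (RE D c ∘ₗ dsE c) = (landauSpace (lapE c) (QpE D)).comap (dsE (P := P) c) := by
  ext x
  rw [LinearMap.mem_ker, LinearMap.comp_apply, Submodule.mem_comap, mem_landauSpace_iff, gauge212_iff_isLandauBG]

end MultiLevel

end

end B8Eq127LandauDictionary

end Literature.MathematicalPhysics.QuantumFieldTheory.Balaban1983to89
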